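import Summits.ResolutionOfSingularities.ResolutionOfSingularities.Theorems.WeightedInvariantKeyRungThreeOfGame
import Summits.ResolutionOfSingularities.ResolutionOfSingularities.Theorems.WeightedInvariantKeyRungThreeOfResidueAllRings
import HarnessLib

/-!
# LEMMA C, the SECOND-MEMBER DOMINANCE THEOREM (hres₃) and the invariance (INV)₃ — UNCONDITIONAL
# (door `HypersurfaceCentreConstruction`, stmt-ResolutionOfSingularities-19897; memos RESIDUE-PLAN.md, LEMMA-C-PRIME.md)

Helper for `stub_keyRungGrHomLE_three` (def-free, `--supports 19897`).  With LEMMA C′ proved (`LemmaCPrime.lemmaC'`, …KeyRungThreeOfGame),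
the conditional results of hands -5 and -6 become theorems BY NAME:
* **`LemmaC.lemmaC`** — LEMMA C (hypothesis `hC` of `keyRungGrHomLE_three_of_lemmaC`) for every field: a pure `Φ ∈ κ[X₁,X₂]` (monomials
  `X₁^{e₁}X₂^{e₂}`, `r₁e₂ + r₂e₁ = r₁ν`) containing `X₂^ν` and written `Σ θ_e η^{e₁} ζ^{e₂}` in weighted-homogeneous `η` (degree `j r₂`, with an
  `X₀^j` term) and `ζ` (degree `j r₁`) is `u (X₂ − a X₁^{r₁/r₂})^ν`, `a ≠ 0` only if `r₂ ∣ r₁` (`LemmaC.lemmaC_of_functional` ∘ `LemmaCPrime.lemmaC'`);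
* **`Iota3.secondMember_mem`** — SECOND-MEMBER DOMINANCE at `q < r₂ < r₁` over EVERY regular local ring of dimension three: under the ratio bound,
  two two-flags carrying `f` to the same exactly ratio-maximal admissible triple have `g₂' ∈ F_{(g₁,g₂)}(r₂)` (`secondMember_mem_of_lemmaC`);
* **`Iota3.levels_le_of_ratioMax`** — (INV)₃: both filtration levels `F'(r₁) ≤ F(r₁)`, `F'(r₂) ≤ F(r₂)` (`levels_le_of_secondMemberResidue`).
[OURS · L1 W4.3; AI work, weaker than expert review; nothing here is a statement of the manuscript under review.]
-/

noncomputable section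

set_option linter.dupNamespace false -- mandated namespace of this single-conjunct summit

open IsLocalRing Literature.AlgebraicGeometry.Resolution MvPolynomial
open Summit.ResolutionOfSingularities.ResolutionOfSingularities.Theorems

namespace Summit.ResolutionOfSingularities.ResolutionOfSingularities.Cruxes.HypersurfaceCentreConstruction.LocalEngine

namespace Iota3

/-- **LEMMA C** (unconditional; see the module docstring). [OURS · L1 W4.3 · (o70-b)/(Δ12)] -/
theorem LemmaC.lemmaC {κ : Type} [Field κ] {r₁ r₂ j ν : ℕ} (hr₂ : 0 < r₂) (hr : r₂ < r₁) (hj : 1 ≤ j) (hν : 1 ≤ ν)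
    (Φ η ζ : MvPolynomial (Fin 3) κ) (s : Finset (Fin 3 →₀ ℕ)) (θ : (Fin 3 →₀ ℕ) → κ)
    (hΦ : ∀ e ∈ Φ.support, e 0 = 0 ∧ r₁ * e 2 + r₂ * e 1 = r₁ * ν) (hΦν : Φ.coeff (Finsupp.single 2 ν) ≠ 0)
    (hηhom : η.IsWeightedHomogeneous (![r₂, j * r₂, j * r₁] : Fin 3 → ℕ) (j * r₂))
    (hē : η.coeff (Finsupp.single 0 j) ≠ 0)
    (hζhom : ζ.IsWeightedHomogeneous (![r₂, j * r₂, j * r₁] : Fin 3 → ℕ) (j * r₁))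
    (hs : ∀ e ∈ s, e 0 = 0 ∧ r₁ * e 2 + r₂ * e 1 = r₁ * ν) (hΦeq : Φ = ∑ e ∈ s, C (θ e) * (η ^ (e 1) * ζ ^ (e 2))) :
    ∃ u a : κ, Φ = C u * (X 2 - C a * X 1 ^ (r₁ / r₂)) ^ ν ∧ (a ≠ 0 → r₂ ∣ r₁) :=
  LemmaC.lemmaC_of_functional hr₂ hr hj hν
    (fun Φ' ε τ hΦ' hΦν' hε hτ hfe => LemmaCPrime.lemmaC' hr₂ hr hj hν Φ' ε τ hΦ' hΦν' hε hτ hfe)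
    Φ η ζ s θ hΦ hΦν hηhom hē hζhom hs hΦeq

/-- **THE SECOND-MEMBER DOMINANCE THEOREM (hres₃), unconditional.**  `A` regular local of Krull dimension `3`, `0 ≠ f ∈ 𝔪`; under the ratio
bound `r₁' b ≤ a r₂'` for every admissible triple reached by `f`, at an exactly ratio-maximal admissible `(q; r₁, r₂)` (`r₁ b = a r₂`) with
`q < r₂ < r₁`: if the two-flags `(g₁, g₂)`, `(g₁', g₂')` both carry `f` to level `r₁ ν`, then `g₂' ∈ F_{(g₁,g₂)}(r₂)`.
(`secondMember_mem_of_lemmaC` with LEMMA C supplied by `LemmaC.lemmaC`.) [OURS · L1 W4.3 · (o70-b)/(Δ12)] -/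
theorem secondMember_mem {A : Type} [CommRing A] [IsRegularLocalRing A] (hdim : ringKrullDim A = (3 : ℕ)) {f : A} (hf0 : f ≠ 0)
    (hfm : f ∈ maximalIdeal A) {a b : ℕ} (hb : 0 < b)
    (hbound : ∀ q' r₁' r₂' : ℕ, AdmissibleTriple q' r₁' r₂' → FlagReaches f (adicOrder f).toNat q' r₁' r₂' → r₁' * b ≤ a * r₂')
    {g₁ g₂ g₁' g₂' : A} {q r₁ r₂ : ℕ} (hadm : AdmissibleTriple q r₁ r₂) (hab : r₁ * b = a * r₂) (hq₂ : q < r₂) (hr : r₂ < r₁)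
    (hΦ : IsTwoFlag g₁ g₂) (hΦ' : IsTwoFlag g₁' g₂')
    (hF : f ∈ flagContactFiltration g₁ g₂ q r₁ r₂ (r₁ * (adicOrder f).toNat))
    (hF' : f ∈ flagContactFiltration g₁' g₂' q r₁ r₂ (r₁ * (adicOrder f).toNat)) :
    g₂' ∈ flagContactFiltration g₁ g₂ q r₁ r₂ r₂ :=
  secondMember_mem_of_lemmaC hdim hf0 hfm
    (fun _ _ _ _ hr₂' hr' hj' hν' Φ η ζ s θ hΦ₀ hΦν hηhom hē hζhom hs hΦeq =>
      LemmaC.lemmaC hr₂' hr' hj' hν' Φ η ζ s θ hΦ₀ hΦν hηhom hē hζhom hs hΦeq)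
    hb hbound hadm hab hq₂ hr hΦ hΦ' hF hF'

/-- **(INV)₃, unconditional**: at a regular local ring of dimension three, two two-flags carrying `0 ≠ g ∈ 𝔪` to the same admissible
triple `(q; r₁, r₂)` of maximal ratio (`q < r₂`) have comparable filtrations at the levels `r₁` and `r₂`:
`F'(r₁) ≤ F(r₁)` and `F'(r₂) ≤ F(r₂)` (hence equal by symmetry).  (`levels_le_of_secondMemberResidue` with the residue supplied by
`secondMember_mem`.) [OURS · L1 W4.3] -/
theorem levels_le_of_ratioMax {A : Type} [CommRing A] [IsRegularLocalRing A] (hdim : ringKrullDim A = (3 : ℕ))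
    {g : A} (hg0 : g ≠ 0) (hgm : g ∈ maximalIdeal A)
    {g₁ g₂ g₁' g₂' : A} {q r₁ r₂ : ℕ} (hΦ : IsTwoFlag g₁ g₂) (hΦ' : IsTwoFlag g₁' g₂') (hadm : AdmissibleTriple q r₁ r₂)
    (hq₂ : q < r₂) (hF : g ∈ flagContactFiltration g₁ g₂ q r₁ r₂ (r₁ * (adicOrder g).toNat))
    (hF' : g ∈ flagContactFiltration g₁' g₂' q r₁ r₂ (r₁ * (adicOrder g).toNat))
    (hmax : ∀ q' r₁' r₂' : ℕ, AdmissibleTriple q' r₁' r₂' → FlagReaches g (adicOrder g).toNat q' r₁' r₂' → r₁' * r₂ ≤ r₁ * r₂') :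
    flagContactFiltration g₁' g₂' q r₁ r₂ r₁ ≤ flagContactFiltration g₁ g₂ q r₁ r₂ r₁ ∧
      flagContactFiltration g₁' g₂' q r₁ r₂ r₂ ≤ flagContactFiltration g₁ g₂ q r₁ r₂ r₂ :=
  levels_le_of_secondMemberResidue hdim hg0 hgm
    (fun _ a b hb hbound _ _ _ _ _ _ _ hadm hab hq₂ hr hΦ hΦ' hF hF' =>
      secondMember_mem hdim hg0 hgm (a := a) (b := b) hb hbound hadm hab hq₂ hr hΦ hΦ' hF hF')
    hΦ hΦ' hadm hq₂ hF hF' hmax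

end Iota3

end Summit.ResolutionOfSingularities.ResolutionOfSingularities.Cruxes.HypersurfaceCentreConstruction.LocalEngine

end
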